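import Mathlib

/-!
# `SnSubsetDichotomy.PolynomialSlack`, line `transport-split-hull` — stub `eventually_log_pow_mul_rpow_le`

The master asymptotic comparison used to discharge every "for `n` large enough" condition of the
induction on `n` behind the polynomial-slack thesis (crux `stmt-MatrixMultiplication-8306`,
registered stub `eventually_log_pow_mul_rpow_le` of
`Cruxes/PolynomialSlack/Lines/transport-split-hull.lean`): any fixed natural power of
`1 + log n` times `n ^ p` is eventually below `n ^ q` when `p < q`, with an arbitrary constant
`c > 0` in front.

Proof.  Along `atTop` in `ℝ`, Mathlib's `isLittleO_log_rpow_rpow_atTop` gives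
`(log x) ^ k = o(x ^ (q - p))`, so eventually `(log x) ^ k ≤ x ^ (q - p) / (c · 2 ^ k)`; once
`log x ≥ 1` we have `(1 + log x) ^ k ≤ (2 log x) ^ k = 2 ^ k (log x) ^ k`, whence
`c (1 + log x) ^ k ≤ x ^ (q - p)` and, multiplying by `x ^ p > 0` (`Real.rpow_add`),
`c (1 + log x) ^ k x ^ p ≤ x ^ q`.  The statement along `n : ℕ` follows by composing with
`Nat.cast → atTop` (`tendsto_natCast_atTop_atTop`) and unfolding `Filter.eventually_atTop`.
-/

namespace Summit.MatrixMultiplication.MatrixMultiplication.Theorems.PolynomialSlack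

-- `Summit.<Summit>.<Problem>` is the tree's mandated summit-side namespace; for this
-- single-conjunct summit the two coincide, so the file silences `dupNamespace`.
set_option linter.dupNamespace false

open Filter Topology

/-- Real-variable form of the polylog-versus-power comparison: for `p < q`, `0 < c` and `k : ℕ`,
eventually along `atTop` in `ℝ`, `c * (1 + log x) ^ k * x ^ p ≤ x ^ q`
(`isLittleO_log_rpow_rpow_atTop` with exponent gap `q - p`, then `Real.rpow_add`). [folklore] -/
theorem eventually_log_pow_mul_rpow_le_real (k : ℕ) (p q c : ℝ) (hpq : p < q) (hc : 0 < c) :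
    ∀ᶠ x : ℝ in atTop, c * (1 + Real.log x) ^ k * x ^ p ≤ x ^ q := by
  have hr : 0 < q - p := sub_pos.2 hpq
  have hε : (0 : ℝ) < 1 / (c * 2 ^ k) := by positivity
  have hlo := (isLittleO_log_rpow_rpow_atTop (k : ℝ) hr).bound hε
  filter_upwards [hlo, Real.tendsto_log_atTop.eventually_ge_atTop 1, eventually_gt_atTop 0]
    with x hx hlog hx0
  have hlog0 : 0 ≤ Real.log x := zero_le_one.trans hlog
  rw [Real.norm_of_nonneg (Real.rpow_nonneg hlog0 _),
    Real.norm_of_nonneg (Real.rpow_nonneg hx0.le _), Real.rpow_natCast] at hx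
  -- `hx : log x ^ k ≤ 1 / (c * 2 ^ k) * x ^ (q - p)`
  have h1 : (1 + Real.log x) ^ k ≤ 2 ^ k * Real.log x ^ k := by
    rw [← mul_pow]
    exact pow_le_pow_left₀ (by linarith) (by linarith) k
  have h2 : c * (1 + Real.log x) ^ k ≤ x ^ (q - p) :=
    calc c * (1 + Real.log x) ^ k ≤ c * (2 ^ k * Real.log x ^ k) :=
          mul_le_mul_of_nonneg_left h1 hc.le
      _ = (c * 2 ^ k) * Real.log x ^ k := by ring
      _ ≤ (c * 2 ^ k) * (1 / (c * 2 ^ k) * x ^ (q - p)) :=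
          mul_le_mul_of_nonneg_left hx (by positivity)
      _ = x ^ (q - p) := by
          rw [← mul_assoc, mul_one_div_cancel (by positivity), one_mul]
  calc c * (1 + Real.log x) ^ k * x ^ p ≤ x ^ (q - p) * x ^ p :=
        mul_le_mul_of_nonneg_right h2 (Real.rpow_nonneg hx0.le p)
    _ = x ^ q := by rw [← Real.rpow_add hx0, sub_add_cancel]

/-- **Polylog times a power is eventually below a larger power** (registered stub
`eventually_log_pow_mul_rpow_le` of line `transport-split-hull`): for `p < q`, `0 < c` and any
`k : ℕ` there is `n₀` with `c * (1 + log n) ^ k * n ^ p ≤ n ^ q` for all naturals `n ≥ n₀`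
(the real-variable form `eventually_log_pow_mul_rpow_le_real` transported along
`tendsto_natCast_atTop_atTop`). [folklore] -/
theorem eventually_log_pow_mul_rpow_le (k : ℕ) (p q c : ℝ) (hpq : p < q) (hc : 0 < c) :
    ∃ n₀ : ℕ, ∀ n : ℕ, n₀ ≤ n → c * (1 + Real.log n) ^ k * (n : ℝ) ^ p ≤ (n : ℝ) ^ q :=
  eventually_atTop.1
    (tendsto_natCast_atTop_atTop.eventually (eventually_log_pow_mul_rpow_le_real k p q c hpq hc))

end Summit.MatrixMultiplication.MatrixMultiplication.Theorems.PolynomialSlack
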